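import Mathlib.ModelTheory.Order
import Mathlib.ModelTheory.Definability
import Mathlib.Order.ConditionallyCompleteLattice.Basic
import Literature.ModelTheory.ExponentialFields.Languages
import HarnessLib

/-!
# Definable completeness and its first-order axiom scheme `[DC]`

Topic `Literature/ModelTheory/ExponentialFields`.  An expansion `M` of an ordered structure is
*definably complete* if every subset of `M` definable with parameters which is non-empty and
bounded above has a least upper bound in `M` (C. Miller, *Expansions of dense linear orders with
the intermediate value property*, J. Symbolic Logic 66 (2001); A. Fornasiero – T. Servi,
*Definably complete Baire structures*, Fund. Math. 209 (2010), Def. 1.5: "An expansion `K` of an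
ordered field is called definably complete if every definable subset of `K` has a supremum in
`K ∪ {±∞}`").  It is the first-order shadow of Dedekind completeness and is expressed by the
axiom scheme `[DC]`: for every formula `φ(ȳ, x)`, "for all `ȳ`, if `{x | φ(ȳ, x)}` is non-empty
and bounded above then it has a least upper bound".  The scheme is the first ingredient of the
recursively axiomatized subtheories of `Th(ℝ_exp)`-like theories used in decidability proofs in
the style of Macintyre–Wilkie (Jones–Servi, J. Symbolic Logic 76 (2011), Def. 1.2 and Def. 2.4:
"[OF] Axioms of ordered field; [DCB] Axioms of definably complete Baire structure; …";
Fornasiero–Servi 2010, Remark 2.10), and all its instances are true in every expansion of `ℝ`,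
`ℝ` being Dedekind complete (Fornasiero–Servi 2010, Examples 2.11).

## Contents (everything proved; no named facts)

* `FirstOrder.Language.IsDefinablyComplete L M` — the notion, a predicate with explicit binders
  in the style of `FirstOrder.Language.IsOMinimal` (`ModelTheoryPreds.lean`); like it, a
  deliberate dot-notation extension of Mathlib's namespace `FirstOrder.Language`;
  `isDefinablyComplete_of_conditionallyCompleteLinearOrder` (every structure on `ℝ`);
* `DefinableCompleteness.upperBound / leastUpperBound / sentence φ` — the instance of `[DC]` at
  `φ : L.BoundedFormula Empty (m + 1)` (parameter variables `&0, …, &(m-1)`, set variable `&m`)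
  and their semantics `realize_upperBound`, `realize_leastUpperBound`, `realize_sentence`;
* `DefinableCompleteness.scheme L : L.Theory` — the scheme `[DC]`; `model_scheme_iff` and
  `model_scheme_iff_isDefinablyComplete` (**a structure is a model of `[DC]` iff it is definably
  complete** — the passage between formulas `φ(ȳ, x)` with variable parameters and Mathlib's
  `Set.Definable₁` over `Set.univ`); `scheme_subset_completeTheory`;
* for `ℝ_exp`: `Real.model_definableCompletenessScheme`, `scheme_subset_realExpTheory`
  (`[DC] ⊆ Th(ℝ_exp)`), `scheme_subset_realOrderedFieldTheory`, and
  `isDefinablyComplete_of_model_realExpTheory` (every model of `T_exp` is definably complete);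
* `IsDefinablyComplete.exists_isGLB` — dually, infima of non-empty bounded-below definable sets.

What is NOT here: the recursiveness of `[DC]` for a recursively presented language
(Fornasiero–Servi 2010, Remark 2.10: "If moreover the language is recursive, this set of
sentences is also recursive"), which needs the arithmetization of syntax of
`Literature/ModelTheory/ProofTheory/`; the Baire scheme of `[DCB]`; and the consequences of
definable completeness for exponential fields (Fornasiero–Servi's o-minimality theorems).

## References

* C. Miller, *Expansions of dense linear orders with the intermediate value property*,
  J. Symbolic Logic 66 (2001) 1783–1790. [Miller2001]
* A. Fornasiero, T. Servi, *Definably complete Baire structures*, Fund. Math. 209 (2010)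
  215–241 (arXiv:0803.3560), Def. 1.5, Remark 2.10, Examples 2.11. [FornasieroServi2010]
* G. O. Jones, T. Servi, *On the decidability of the real field with a generic power function*,
  J. Symbolic Logic 76 (2011) 1418–1428, Def. 1.2, Def. 2.4. [JonesServi2011]
-/

universe u v w

open FirstOrder FirstOrder.Language FirstOrder.Language.Structure Set

namespace FirstOrder.Language

/-- **Definable completeness** (Miller 2001; Fornasiero–Servi 2010, Def. 1.5: "An expansion `K`
of an ordered field is called definably complete if every definable subset of `K` has a supremum
in `K ∪ {±∞}`" — equivalently, as here, every subset of `M` definable with parameters from `M`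
which is non-empty and bounded above has a least upper bound in `M`; the empty set and the
unbounded sets are the cases of supremum `-∞`, `+∞`).  A predicate on the structure with `L` and
`M` as explicit binders (compare `FirstOrder.Language.IsOMinimal`), a deliberate dot-notation
extension of Mathlib's namespace `FirstOrder.Language`; not a claim.  It holds for every
structure on `ℝ` (`isDefinablyComplete_of_conditionallyCompleteLinearOrder`) and is axiomatized
by the scheme `Literature.ModelTheory.ExponentialFields.DefinableCompleteness.scheme`
(`model_scheme_iff_isDefinablyComplete`). [cite: FornasieroServi2010, Def. 1.5] -/
def IsDefinablyComplete (L : Language.{u, v}) (M : Type w) [L.Structure M] [LE M] : Prop :=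
  ∀ s : Set M, (Set.univ : Set M).Definable₁ L s → s.Nonempty → BddAbove s → ∃ a, IsLUB s a

variable {L : Language.{u, v}} {M : Type w} [L.Structure M]

/-- Unfolding lemma for `Language.IsDefinablyComplete`. [cite: FornasieroServi2010, Def. 1.5] -/
theorem isDefinablyComplete_iff [LE M] : L.IsDefinablyComplete M ↔
    ∀ s : Set M, (Set.univ : Set M).Definable₁ L s → s.Nonempty → BddAbove s → ∃ a, IsLUB s a :=
  Iff.rfl

/-- A conditionally complete linear order — e.g. `ℝ` — is definably complete whatever the
structure on it: every non-empty bounded-above subset has a supremum (Fornasiero–Servi 2010,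
Examples 2.11: "Every expansion of `ℝ` (because `ℝ` is Dedekind complete …)"). [cite: FornasieroServi2010, Examples 2.11] -/
theorem isDefinablyComplete_of_conditionallyCompleteLinearOrder {M : Type w} [L.Structure M]
    [ConditionallyCompleteLinearOrder M] : L.IsDefinablyComplete M :=
  fun s _ hne hbdd => ⟨sSup s, isLUB_csSup hne hbdd⟩

end FirstOrder.Language

namespace Literature.ModelTheory.ExponentialFields

namespace DefinableCompleteness

variable {L : Language.{u, v}} {M : Type w} [L.Structure M] {m : ℕ}

/-! ### The set `{x | φ(ȳ, x)}` of a formula with variable parameters is definable -/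

/-- For a formula `φ(ȳ, x)` (`φ : L.BoundedFormula Empty (m + 1)`, parameters `&0, …, &(m-1)`,
`x = &m`) and values `ȳ ∈ Mᵐ`, the set `{x | φ(ȳ, x)}` is definable with parameters in the
sense of Mathlib's `Set.Definable₁` over `Set.univ`. [folklore] -/
theorem definable₁_setOf_realize_snoc (φ : L.BoundedFormula Empty (m + 1)) (ys : Fin m → M) :
    (Set.univ : Set M).Definable₁ L {x | φ.Realize default (Fin.snoc ys x)} := by
  rw [Set.Definable₁, Set.definable_iff_exists_formula_sum]
  refine ⟨φ.toFormula.relabel (Sum.elim Empty.elim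
    (Fin.lastCases (Sum.inr 0) fun i => Sum.inl ⟨ys i, Set.mem_univ _⟩)), ?_⟩
  ext w
  simp only [Set.mem_setOf_eq, Formula.realize_relabel, BoundedFormula.realize_toFormula]
  refine Iff.of_eq (congrArg₂ (BoundedFormula.Realize φ) (Subsingleton.elim _ _) ?_)
  funext i
  refine Fin.lastCases ?_ (fun j => ?_) i <;> simp

variable [L.IsOrdered]

/-! ### The instance of the scheme at a formula `φ(ȳ, x)` -/

/-- For `φ(ȳ, x)` (`ȳ = &0, …, &(m-1)`, `x = &m`): the formula `ub_φ(ȳ, b) := ∀ x (φ(ȳ, x) → x ≤ b)`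
in the variables `ȳ` and `b = &m` — "`b` is an upper bound of `{x | φ(ȳ, x)}`". [folklore] -/
def upperBound (φ : L.BoundedFormula Empty (m + 1)) : L.BoundedFormula Empty (m + 1) :=
  ∀' (φ.liftAt 1 m ⟹ (var (Sum.inr (Fin.last (m + 1)))).le (var (Sum.inr (Fin.last m).castSucc)))

/-- For `φ(ȳ, x)`: the formula `lub_φ(ȳ, s) := ub_φ(ȳ, s) ∧ ∀ c (ub_φ(ȳ, c) → s ≤ c)` in the
variables `ȳ` and `s = &m` — "`s` is a least upper bound of `{x | φ(ȳ, x)}`". [folklore] -/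
def leastUpperBound (φ : L.BoundedFormula Empty (m + 1)) : L.BoundedFormula Empty (m + 1) :=
  upperBound φ ⊓
    ∀' ((upperBound φ).liftAt 1 m ⟹
      (var (Sum.inr (Fin.last m).castSucc)).le (var (Sum.inr (Fin.last (m + 1)))))

/-- **The instance of `[DC]` at `φ(ȳ, x)`**: the sentence
`∀ ȳ ((∃ x φ(ȳ, x)) → (∃ b ub_φ(ȳ, b)) → ∃ s lub_φ(ȳ, s))` — "for all `ȳ`, if `{x | φ(ȳ, x)}` is
non-empty and bounded above then it has a least upper bound" (Fornasiero–Servi 2010, Def. 1.5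
with Remark 2.10; Jones–Servi 2011, Def. 1.2, scheme [DCB]). [cite: FornasieroServi2010, Def. 1.5] -/
def sentence (φ : L.BoundedFormula Empty (m + 1)) : L.Sentence :=
  (∃' φ ⟹ ∃' (upperBound φ) ⟹ ∃' (leastUpperBound φ)).alls

variable (L) in
/-- **The definable completeness scheme `[DC]`** of an ordered language `L`: the set of the
sentences `sentence φ`, `φ(ȳ, x)` ranging over all `L`-formulas with any number `m` of parameter
variables (Fornasiero–Servi 2010, Def. 1.5 / Remark 2.10; Jones–Servi 2011, Def. 1.2). Its
models are exactly the definably complete `L`-structures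
(`model_scheme_iff_isDefinablyComplete`). [cite: FornasieroServi2010, Def. 1.5] -/
def scheme : L.Theory :=
  {σ | ∃ (m : ℕ) (φ : L.BoundedFormula Empty (m + 1)), sentence φ = σ}

/-- Each instance `sentence φ` belongs to the scheme. [folklore] -/
theorem sentence_mem_scheme (φ : L.BoundedFormula Empty (m + 1)) : sentence φ ∈ scheme L :=
  ⟨m, φ, rfl⟩

/-! ### Semantics -/

omit [L.Structure M] [L.IsOrdered] in
/-- Variable bookkeeping for `liftAt 1 m` under two further binders: evaluating the lifted formula
at `(ȳ, b, x)` evaluates the original one at `(ȳ, x)`. [folklore] -/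
theorem snoc_snoc_comp_lift (ys : Fin m → M) (b x : M) :
    ((Fin.snoc (Fin.snoc ys b : Fin (m + 1) → M) x : Fin (m + 1 + 1) → M) ∘
        fun i : Fin (m + 1) => if (i : ℕ) < m then i.castSucc else i.succ) =
      Fin.snoc ys x := by
  funext i
  refine Fin.lastCases ?_ (fun j => ?_) i
  · simp [Fin.succ_last]
  · simp

/-- Semantics of `upperBound`: at `(ȳ, b)` it says that `b` bounds `{x | φ(ȳ, x)}` from above.
[folklore] -/
theorem realize_upperBound [LE M] [L.OrderedStructure M] (φ : L.BoundedFormula Empty (m + 1))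
    (ys : Fin m → M) (b : M) :
    (upperBound φ).Realize default (Fin.snoc ys b) ↔
      ∀ x, φ.Realize default (Fin.snoc ys x) → x ≤ b := by
  simp only [upperBound, BoundedFormula.realize_all, BoundedFormula.realize_imp,
    BoundedFormula.realize_liftAt_one m.le_succ, snoc_snoc_comp_lift, Term.realize_le,
    Term.realize_var, Sum.elim_inr, Fin.snoc_last, Fin.snoc_castSucc]

/-- Semantics of `leastUpperBound`: at `(ȳ, s)` it says that `s` is a least upper bound of
`{x | φ(ȳ, x)}` (Mathlib's `IsLUB`). [folklore] -/
theorem realize_leastUpperBound [LE M] [L.OrderedStructure M]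
    (φ : L.BoundedFormula Empty (m + 1)) (ys : Fin m → M) (s : M) :
    (leastUpperBound φ).Realize default (Fin.snoc ys s) ↔
      IsLUB {x | φ.Realize default (Fin.snoc ys x)} s := by
  simp only [leastUpperBound, BoundedFormula.realize_inf, BoundedFormula.realize_all,
    BoundedFormula.realize_imp, BoundedFormula.realize_liftAt_one m.le_succ, snoc_snoc_comp_lift,
    realize_upperBound, Term.realize_le, Term.realize_var, Sum.elim_inr, Fin.snoc_last,
    Fin.snoc_castSucc]
  rfl

/-- Semantics of the instance `sentence φ` of `[DC]`: for all `ȳ`, if `{x | φ(ȳ, x)}` is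
non-empty and bounded above then it has a least upper bound. [cite: FornasieroServi2010, Def. 1.5] -/
theorem realize_sentence [LE M] [L.OrderedStructure M] (φ : L.BoundedFormula Empty (m + 1)) :
    M ⊨ sentence φ ↔ ∀ ys : Fin m → M,
      {x | φ.Realize default (Fin.snoc ys x)}.Nonempty →
        BddAbove {x | φ.Realize default (Fin.snoc ys x)} →
          ∃ s, IsLUB {x | φ.Realize default (Fin.snoc ys x)} s := by
  simp only [sentence, Sentence.Realize, BoundedFormula.realize_alls,
    BoundedFormula.realize_imp, BoundedFormula.realize_ex, realize_upperBound,
    realize_leastUpperBound]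
  rfl

/-- A structure is a model of `[DC]` iff for every formula `φ(ȳ, x)` and all `ȳ` the set
`{x | φ(ȳ, x)}`, when non-empty and bounded above, has a least upper bound. [cite: FornasieroServi2010, Def. 1.5] -/
theorem model_scheme_iff [LE M] [L.OrderedStructure M] :
    M ⊨ scheme L ↔ ∀ (m : ℕ) (φ : L.BoundedFormula Empty (m + 1)) (ys : Fin m → M),
      {x | φ.Realize default (Fin.snoc ys x)}.Nonempty →
        BddAbove {x | φ.Realize default (Fin.snoc ys x)} →
          ∃ s, IsLUB {x | φ.Realize default (Fin.snoc ys x)} s := by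
  simp only [Theory.model_iff, scheme, Set.mem_setOf_eq]
  constructor
  · intro h m φ
    exact (realize_sentence φ).1 (h _ ⟨m, φ, rfl⟩)
  · rintro h σ ⟨m, φ, rfl⟩
    exact (realize_sentence φ).2 (h m φ)

/-- **The models of `[DC]` are exactly the definably complete structures** (Fornasiero–Servi
2010, Def. 1.5 and Remark 2.10: definable completeness "can be expressed by a set of first-order
sentences").  The proof passes between formulas `φ(ȳ, x)` with variable parameters and Mathlib's
sets definable with parameters (`Set.Definable₁` over `Set.univ`, through
`Set.definable_iff_finitely_definable` and an enumeration of the finitely many parameters used).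
[cite: FornasieroServi2010, Def. 1.5] -/
theorem model_scheme_iff_isDefinablyComplete [LE M] [L.OrderedStructure M] :
    M ⊨ scheme L ↔ L.IsDefinablyComplete M := by
  classical
  refine ⟨fun h s hs hne hbdd => ?_, fun h => model_scheme_iff.2 fun m φ ys hne hbdd =>
    h _ (definable₁_setOf_realize_snoc φ ys) hne hbdd⟩
  rw [Set.Definable₁, Set.definable_iff_finitely_definable] at hs
  obtain ⟨A0, -, hA0⟩ := hs
  rw [Set.definable_iff_exists_formula_sum] at hA0
  obtain ⟨ψ, hψ⟩ := hA0
  -- enumerate the finitely many parameters `A0` and turn them into bound variables `ȳ`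
  set k := Fintype.card (A0 : Set M) with hk
  let e : (A0 : Set M) ≃ Fin k := Fintype.equivFin _
  let g : (A0 : Set M) ⊕ Fin 1 → Empty ⊕ Fin (k + 1) :=
    Sum.inr ∘ Sum.elim (Fin.castSucc ∘ e) fun _ => Fin.last k
  let φ : L.BoundedFormula Empty (k + 1) := BoundedFormula.relabel g ψ
  let ys : Fin k → M := fun i => (e.symm i : M)
  have hS : {x | φ.Realize default (Fin.snoc ys x)} = s := by
    ext x
    have hx := congrArg (fun S : Set (Fin 1 → M) => (fun _ : Fin 1 => x) ∈ S) hψ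
    simp only [Set.mem_setOf_eq, eq_iff_iff] at hx
    rw [Set.mem_setOf_eq, hx]
    simp only [φ]
    rw [BoundedFormula.realize_relabel, Formula.Realize]
    refine Iff.of_eq (congrArg₂ (BoundedFormula.Realize ψ) ?_ (Subsingleton.elim _ _))
    funext a
    rcases a with a | j
    · simp [g, ys]
    · simp [g]
  obtain ⟨a, ha⟩ := (model_scheme_iff.1 h) k φ ys (hS ▸ hne) (hS ▸ hbdd)
  exact ⟨a, hS ▸ ha⟩

/-- Models of `[DC]` are definably complete. [cite: FornasieroServi2010, Def. 1.5] -/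
theorem isDefinablyComplete_of_model [LE M] [L.OrderedStructure M] [M ⊨ scheme L] :
    L.IsDefinablyComplete M :=
  model_scheme_iff_isDefinablyComplete.1 ‹_›

/-- Definably complete structures are models of `[DC]`. [cite: FornasieroServi2010, Def. 1.5] -/
theorem model_scheme_of_isDefinablyComplete [LE M] [L.OrderedStructure M]
    (h : L.IsDefinablyComplete M) : M ⊨ scheme L :=
  model_scheme_iff_isDefinablyComplete.2 h

/-- Every instance of `[DC]` is true in a definably complete structure: `[DC] ⊆ Th(M)`.
[cite: FornasieroServi2010, Def. 1.5] -/
theorem scheme_subset_completeTheory [LE M] [L.OrderedStructure M]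
    (h : L.IsDefinablyComplete M) : scheme L ⊆ L.completeTheory M :=
  fun _ hσ => (Theory.model_iff _).1 (model_scheme_of_isDefinablyComplete h) _ hσ

/-- In particular every structure on a conditionally complete linear order (every expansion of
`ℝ`) is a model of `[DC]` (Fornasiero–Servi 2010, Examples 2.11). [cite: FornasieroServi2010, Examples 2.11] -/
theorem model_scheme_of_conditionallyCompleteLinearOrder {M : Type w} [L.Structure M]
    [ConditionallyCompleteLinearOrder M] [L.OrderedStructure M] : M ⊨ scheme L :=
  model_scheme_of_isDefinablyComplete isDefinablyComplete_of_conditionallyCompleteLinearOrder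

/-! ### Infima -/

omit [L.IsOrdered] in
/-- The set of lower bounds of a set definable with parameters is definable with parameters (in a
structure interpreting the symbol `≤` of `L` by its order). [folklore] -/
theorem definable₁_lowerBounds [L.IsOrdered] [Preorder M] [L.OrderedStructure M] {s : Set M}
    (hs : (Set.univ : Set M).Definable₁ L s) :
    (Set.univ : Set M).Definable₁ L (lowerBounds s) := by
  rw [Set.Definable₁, Set.definable_iff_exists_formula_sum] at hs ⊢
  obtain ⟨ψ, hψ⟩ := hs
  have hy : ∀ y : M, y ∈ s ↔ ψ.Realize (Sum.elim Subtype.val fun _ : Fin 1 => y) := fun y => by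
    have := congrArg (fun S : Set (Fin 1 → M) => (fun _ : Fin 1 => y) ∈ S) hψ
    simpa only [Set.mem_setOf_eq, eq_iff_iff] using this
  let g : (↥(Set.univ : Set M) ⊕ Fin 1) → (↥(Set.univ : Set M) ⊕ Fin 1) ⊕ Fin 1 :=
    Sum.elim (fun a => Sum.inl (Sum.inl a)) fun _ => Sum.inr 0
  let ψ' : L.BoundedFormula (↥(Set.univ : Set M) ⊕ Fin 1) 1 := BoundedFormula.relabel g ψ
  refine ⟨∀' (ψ' ⟹ (var (Sum.inl (Sum.inr 0))).le (var (Sum.inr 0))), ?_⟩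
  ext v
  simp only [Set.mem_setOf_eq, mem_lowerBounds, Formula.Realize, BoundedFormula.realize_all,
    BoundedFormula.realize_imp, Term.realize_le, Term.realize_var, Sum.elim_inl, Sum.elim_inr,
    Fin.snoc_zero]
  refine forall_congr' fun y => ?_
  have hψ' : ψ'.Realize (Sum.elim Subtype.val v) (fun _ => y) ↔ y ∈ s := by
    rw [hy y]
    simp only [ψ']
    rw [BoundedFormula.realize_relabel, Formula.Realize]
    refine Iff.of_eq (congrArg₂ (BoundedFormula.Realize ψ) ?_ (Subsingleton.elim _ _))
    funext a
    rcases a with a | j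
    · simp [g]
    · simp [g]
  rw [hψ']

omit [L.IsOrdered] in
/-- In a definably complete structure every non-empty bounded-below set definable with parameters
has a greatest lower bound (apply definable completeness to its definable set of lower bounds;
compare Fornasiero–Servi 2010, §1.2). [folklore] -/
theorem _root_.FirstOrder.Language.IsDefinablyComplete.exists_isGLB [L.IsOrdered] [Preorder M]
    [L.OrderedStructure M] (h : L.IsDefinablyComplete M) {s : Set M}
    (hs : (Set.univ : Set M).Definable₁ L s) (hne : s.Nonempty) (hbdd : BddBelow s) :
    ∃ a, IsGLB s a := by
  obtain ⟨a, ha⟩ := h (lowerBounds s) (definable₁_lowerBounds hs) hbdd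
    (hne.mono (subset_upperBounds_lowerBounds s))
  exact ⟨a, isLUB_lowerBounds.1 ha⟩

end DefinableCompleteness

/-! ### The real exponential field and the models of its theory -/

/-- `ℝ_exp` is definably complete (as is every structure on `ℝ`). [cite: FornasieroServi2010, Examples 2.11] -/
theorem real_isDefinablyComplete : Language.orderedExpRing.IsDefinablyComplete ℝ :=
  isDefinablyComplete_of_conditionallyCompleteLinearOrder

/-- `ℝ_exp` is a model of the definable completeness scheme `[DC]` of its language.
[cite: FornasieroServi2010, Examples 2.11] -/
instance Real.model_definableCompletenessScheme :
    ℝ ⊨ DefinableCompleteness.scheme Language.orderedExpRing :=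
  DefinableCompleteness.model_scheme_of_conditionallyCompleteLinearOrder

/-- **`[DC] ⊆ T_exp`**: every instance of the definable completeness scheme in the language
`(+, *, -, 0, 1, exp, ≤)` is true in `ℝ_exp`, i.e. the scheme is a set of axioms of
`realExpTheory = Th(ℝ_exp)` (the form in which it enters recursively axiomatized subtheories of
theories of expansions of the real field: Jones–Servi 2011, Def. 1.2, "[DCB]"; Fornasiero–Servi
2010, Examples 2.11). [cite: JonesServi2011, Def. 1.2] -/
theorem DefinableCompleteness.scheme_subset_realExpTheory :
    DefinableCompleteness.scheme Language.orderedExpRing ⊆ realExpTheory :=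
  DefinableCompleteness.scheme_subset_completeTheory real_isDefinablyComplete

/-- Likewise in the language of ordered rings: `[DC] ⊆ Th(ℝ; +, *, -, 0, 1, ≤)`.
[cite: FornasieroServi2010, Examples 2.11] -/
theorem DefinableCompleteness.scheme_subset_realOrderedFieldTheory :
    DefinableCompleteness.scheme Language.orderedRing ⊆ realOrderedFieldTheory :=
  DefinableCompleteness.scheme_subset_completeTheory
    isDefinablyComplete_of_conditionallyCompleteLinearOrder

/-- Every model of `T_exp = Th(ℝ_exp)` is a model of `[DC]` (`[DC] ⊆ T_exp`). [folklore] -/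
theorem model_definableCompletenessScheme_of_model_realExpTheory (N : Type*)
    [Language.orderedExpRing.Structure N] [N ⊨ realExpTheory] :
    N ⊨ DefinableCompleteness.scheme Language.orderedExpRing :=
  Theory.Model.mono ‹_› DefinableCompleteness.scheme_subset_realExpTheory

/-- Every model of `T_exp = Th(ℝ_exp)` (with `≤` interpreted by its order) is definably complete
— definable completeness "is a weak version of Dedekind completeness, which is preserved under
elementary equivalence" (Fornasiero–Servi 2010, §1). [cite: FornasieroServi2010, §1] -/
theorem isDefinablyComplete_of_model_realExpTheory (N : Type*)
    [Language.orderedExpRing.Structure N] [LE N] [Language.orderedExpRing.OrderedStructure N]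
    [N ⊨ realExpTheory] : Language.orderedExpRing.IsDefinablyComplete N :=
  DefinableCompleteness.model_scheme_iff_isDefinablyComplete.1
    (model_definableCompletenessScheme_of_model_realExpTheory N)

end Literature.ModelTheory.ExponentialFields
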